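import Literature.Probability.RandomPlanarGeometry.SLEKappaRhoMartingaleAlgebra
import Literature.Analysis.Complex.CauchyTaylorBall
import Mathlib.Analysis.Complex.RemovableSingularity
import Mathlib.Analysis.SpecialFunctions.Complex.LogDeriv
import Mathlib.Analysis.SpecialFunctions.Complex.LogBounds
import HarnessLib

/-!
# [LSW] Lemma 8.9: `log M` as a holomorphic function of the two evaluation points, and its second-order expansion

G. F. Lawler, O. Schramm, W. Werner, *Conformal restriction: the chordal case*, J. Amer. Math.
Soc. **16** (2003) 917–955, arXiv:math/0209343 (**[LSW]**), §8.4, proof of Lemma 8.9: Itô's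
formula is applied to `M_t = h_t'(W_t)^{5/8} h_t'(O_t)^b [(h_t(W_t) − h_t(O_t))/(W_t − O_t)]^c`,
i.e. to `exp L_t`, `L = (5/8) log h'(W) + b log h'(O) + c log[(h(W) − h(O))/(W − O)]`, through the
displayed differentials of `h(W)`, `h'(W)`, `h(O)`, `h'(O)` — a second-order expansion in the
increment of `W` and a first-order one in the increments of `O` and of the time.

The tree proves Lemma 8.9 by conditional increments (plan in `SLEKappaRhoMartingale`), which
requires this expansion with a UNIFORM remainder, in particular uniform as `W_t − O_t → 0`
(`O_0 = W_0`, and the force point is hit again when `ρ < −2/3`), where the printed term-by-term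
form degenerates (`log(h(W) − h(O))` and `log(W − O)` are separately singular). This file supplies
the expansion in a form that is regular across the diagonal: for a holomorphic `E` (the reflected
map `E_B` of the slid hull, `W ↦ 0`, `O ↦ o ≤ 0`) the slope factor is the DIVIDED DIFFERENCE
`DQ E x y = (E x − E y)/(x − y)` (`= dslope E y x`, holomorphic in each variable up to and across
`x = y`, `Complex.differentiableOn_dslope`), and

  `ell E ρ x y = (5/8) log E'(x) + b log E'(y) + c log DQ E x y`       (`M = exp ∘ ell` at `(0, o)`)

is expanded at `(0, y₀)` to second order in `x` and first order in the displacement `a` of `y`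
by CAUCHY ESTIMATES alone (`Literature.Analysis.Complex.CauchyTaylorBall`): under the quantitative
control `JetControl E δ η R` (holomorphy on a box around `[−R−3, 0]`, `δ ≤ Re E' `, `|E'| ≤ 2`,
`E(0) = 0`, `E` real on the axis) one has `|ell| ≤ ellBound ρ δ` on the box, whence

* `norm_ell_sub_taylor_x`, `norm_ell_sub_taylor_y` — the one-variable Taylor remainders
  (`O(|x|³)` in `x`, `O(|a|²)` in `y`), with coefficients the honest derivatives
  `deriv`/`iteratedDeriv 2` of the slices;
* `norm_deriv_slice_sub_le`, `norm_iteratedDeriv_slice_sub_le` — the `x`-coefficients are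
  Lipschitz in `y` (Cauchy estimate applied to the difference of two `x`-slices, which is small
  by the Lipschitz bound in `y`);
* `norm_ell_sub_ell_sub_le` — **the joint expansion**
  `ell(x, y₀ + a) − ell(0, y₀) = ℓ₁ x + m₁ a + ½ ℓ₂ x² + O(|x|³ + |x||a| + |a|²)` with explicit
  constants (uniform in `y₀ ∈ [−R−2, η]`, in particular across the diagonal `y₀ = 0`);
* `norm_exp_sub_one_sub_le`, `norm_exp_sub_model_le` — exponentiation: `exp Δ − 1 =
  ℓ₁ x + m₁ a + ½(ℓ₂ + ℓ₁²) x² + O(…)`, the form `dM/M = dL + ½ (dL)²` of Itô's formula for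
  `M = exp L`.

The identification of `exp (ell E_B ρ 0 o)` with `oneSidedM ρ B o`, the closed forms of
`ℓ₁, m₁, ℓ₂` (the printed coefficients) and the drift identity are in the sequel files. No named
facts; definitions: `jetBox`, `JetControl` (a hypothesis bundle), `DQ`, `ell`, `logBound`,
`ellBound`.

## References

* [LSW] §8.4, proof of Lemma 8.9 (the displayed differentials and "Using these expressions in
  Itô's formula for `dM_t`"). [LawlerSchrammWerner2003Restriction]
* L. Hörmander, *An Introduction to Complex Analysis in Several Variables* (1973), Thm. 2.2.7
  (Cauchy's inequalities).
-/

noncomputable section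

open Set Filter Metric Complex MeasureTheory
open scoped Topology Real

namespace Literature.Probability.RandomPlanarGeometry

namespace SLEKappaRho

open Literature.Analysis.Complex

/-! ### The box around `[−R−3, 0]` and the control of `E` -/

/-- The open box `{−R−3 < Re z < 2η, |Im z| < 2η}` around the real segment carrying the two
evaluation points `O ≤ W` (in slid coordinates `o ∈ [−R, 0]`, `0`). [folklore] -/
def jetBox (R η : ℝ) : Set ℂ := {z : ℂ | z.re ∈ Ioo (-R - 3) (2 * η) ∧ |z.im| < 2 * η}

/-- Membership in the box. [folklore] -/
theorem mem_jetBox_iff {R η : ℝ} {z : ℂ} :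
    z ∈ jetBox R η ↔ (-R - 3 < z.re ∧ z.re < 2 * η) ∧ |z.im| < 2 * η := Iff.rfl

/-- The box as an intersection of four open half-planes. [folklore] -/
theorem jetBox_eq (R η : ℝ) : jetBox R η =
    (({z : ℂ | -R - 3 < z.re} ∩ {z : ℂ | z.re < 2 * η}) ∩ {z : ℂ | z.im < 2 * η}) ∩ {z : ℂ | -(2 * η) < z.im} := by
  ext z
  simp only [jetBox, mem_Ioo, mem_setOf_eq, mem_inter_iff, abs_lt]
  tauto

/-- The box is open. [folklore] -/
theorem isOpen_jetBox (R η : ℝ) : IsOpen (jetBox R η) := by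
  rw [jetBox_eq]
  refine ((IsOpen.inter ?_ ?_).inter ?_).inter ?_
  · exact isOpen_lt continuous_const Complex.continuous_re
  · exact isOpen_lt Complex.continuous_re continuous_const
  · exact isOpen_lt Complex.continuous_im continuous_const
  · exact isOpen_lt continuous_const Complex.continuous_im

/-- The box is convex. [folklore] -/
theorem convex_jetBox (R η : ℝ) : Convex ℝ (jetBox R η) := by
  rw [jetBox_eq]
  exact (((convex_halfSpace_re_gt _).inter (convex_halfSpace_re_lt _)).inter
    (convex_halfSpace_im_lt _)).inter (convex_halfSpace_im_gt _)

/-- **The segment `y + t(x − y)`, `t ∈ [0, 1]`, between two points of the box stays in the box.**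
[folklore] -/
theorem add_smul_sub_mem_jetBox {R η : ℝ} {x y : ℂ} (hx : x ∈ jetBox R η) (hy : y ∈ jetBox R η)
    {t : ℝ} (ht : t ∈ Icc (0 : ℝ) 1) : y + (t : ℂ) * (x - y) ∈ jetBox R η := by
  have h := (convex_jetBox R η).add_smul_sub_mem hy hx ht
  simpa [Complex.real_smul] using h

/-- A ball of radius `η` around a real point of `[−R−2, η]` lies in the box. [folklore] -/
theorem ball_subset_jetBox {R η : ℝ} (hη1 : η ≤ 1) {y₀ : ℝ} (hy₀ : y₀ ∈ Icc (-R - 2) η) :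
    ball (y₀ : ℂ) η ⊆ jetBox R η := by
  intro z hz
  rw [mem_ball, dist_eq_norm] at hz
  have hre : |z.re - y₀| < η := by
    have := abs_re_le_norm (z - y₀); simp at this; linarith
  have him : |z.im| < η := by
    have := abs_im_le_norm (z - y₀); simp at this; linarith
  have hη : 0 < η := lt_of_le_of_lt (abs_nonneg _) him
  rw [abs_lt] at hre
  exact ⟨⟨by linarith [hy₀.1], by linarith [hy₀.2]⟩, by linarith⟩

/-- In particular `ball 0 η ⊆ jetBox R η` (`R ≥ 0`, `0 < η ≤ 1`). [folklore] -/
theorem ball_zero_subset_jetBox {R η : ℝ} (hR : 0 ≤ R) (hη : 0 < η) (hη1 : η ≤ 1) :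
    ball (0 : ℂ) η ⊆ jetBox R η := by
  have := ball_subset_jetBox (R := R) hη1 (y₀ := 0) ⟨by linarith, hη.le⟩
  simpa using this

/-- **Quantitative control of the holomorphic map `E` on the box** (a hypothesis bundle, not a
named fact): holomorphy on the box, `|E'| ≤ 2` and `Re E' ≥ δ > 0` there, `E(0) = 0`, `E` real on
the real points of the box. For the reflected map `E_B` of a slid hull these are supplied by the
localisation (Schwarz–Pick bound, monotonicity of `h_t'`, [LSW] (8.2)). [folklore] -/
structure JetControl (E : ℂ → ℂ) (δ η R : ℝ) : Prop where
  δ_pos : 0 < δ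
  η_pos : 0 < η
  η_le_one : η ≤ 1
  R_nonneg : 0 ≤ R
  differentiableOn : DifferentiableOn ℂ E (jetBox R η)
  norm_deriv_le : ∀ z ∈ jetBox R η, ‖deriv E z‖ ≤ 2
  le_re_deriv : ∀ z ∈ jetBox R η, δ ≤ (deriv E z).re
  map_zero : E 0 = 0
  im_ofReal : ∀ x : ℝ, (x : ℂ) ∈ jetBox R η → (E x).im = 0

namespace JetControl

variable {E : ℂ → ℂ} {δ η R : ℝ}

/-- `E'` is holomorphic on the box. [folklore] -/
theorem differentiableOn_deriv (hc : JetControl E δ η R) : DifferentiableOn ℂ (deriv E) (jetBox R η) :=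
  ((hc.differentiableOn.analyticOnNhd (isOpen_jetBox R η)).deriv).differentiableOn

/-- `E'` is continuous on the box. [folklore] -/
theorem continuousOn_deriv (hc : JetControl E δ η R) : ContinuousOn (deriv E) (jetBox R η) :=
  hc.differentiableOn_deriv.continuousOn

/-- `E'(z)` lies in the slit plane (positive real part). [folklore] -/
theorem deriv_mem_slitPlane (hc : JetControl E δ η R) {z : ℂ} (hz : z ∈ jetBox R η) :
    deriv E z ∈ slitPlane :=
  mem_slitPlane_iff.2 (Or.inl (hc.δ_pos.trans_le (hc.le_re_deriv z hz)))

/-- `0` lies in the box. [folklore] -/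
theorem zero_mem (hc : JetControl E δ η R) : (0 : ℂ) ∈ jetBox R η :=
  ball_zero_subset_jetBox hc.R_nonneg hc.η_pos hc.η_le_one (mem_ball_self hc.η_pos)

end JetControl

/-! ### The divided difference `DQ E x y = (E x − E y)/(x − y)` -/

/-- **The divided difference of `E`**, `DQ E x y = (E x − E y)/(x − y)` for `x ≠ y` and `E'(y)` on
the diagonal (Mathlib's `dslope E y x`); in slid coordinates `(h_t(W_t) − h_t(O_t))/(W_t − O_t)`
is `DQ E_B 0 o` ([LSW] §8.4: "when `W_t = O_t`, we take `M_t = h_t'(W_t)^{(5/8)+b+c}`", i.e. the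
diagonal value `E'`). [cite: LawlerSchrammWerner2003Restriction, §8.4 (definition of M_t)] -/
def DQ (E : ℂ → ℂ) (x y : ℂ) : ℂ := dslope E y x

section DQ

variable {E : ℂ → ℂ} {δ η R : ℝ}

/-- On the diagonal the divided difference is the derivative. [folklore] -/
theorem DQ_same (E : ℂ → ℂ) (y : ℂ) : DQ E y y = deriv E y := dslope_same E y

/-- Off the diagonal it is the difference quotient. [folklore] -/
theorem DQ_of_ne (E : ℂ → ℂ) {x y : ℂ} (h : x ≠ y) : DQ E x y = (E x - E y) / (x - y) := by
  rw [DQ, dslope_of_ne E h, slope_def_field]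

/-- The divided difference is symmetric. [folklore] -/
theorem DQ_comm (E : ℂ → ℂ) (x y : ℂ) : DQ E x y = DQ E y x := by
  rcases eq_or_ne x y with rfl | h
  · rfl
  · rw [DQ_of_ne E h, DQ_of_ne E h.symm, ← neg_sub (E x) (E y), ← neg_sub x y, neg_div_neg_eq]

/-- `DQ E x y · (x − y) = E x − E y`. [folklore] -/
theorem DQ_mul_sub (E : ℂ → ℂ) (x y : ℂ) : DQ E x y * (x - y) = E x - E y := by
  rcases eq_or_ne x y with rfl | h
  · simp
  · rw [DQ_of_ne E h, div_mul_cancel₀ _ (sub_ne_zero.2 h)]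

/-- **`x ↦ DQ E x y` is holomorphic on the box** (removable singularity on the diagonal).
[folklore] -/
theorem differentiableOn_DQ_left (hc : JetControl E δ η R) {y : ℂ} (hy : y ∈ jetBox R η) :
    DifferentiableOn ℂ (fun x ↦ DQ E x y) (jetBox R η) :=
  (Complex.differentiableOn_dslope ((isOpen_jetBox R η).mem_nhds hy)).2 hc.differentiableOn

/-- **`y ↦ DQ E x y` is holomorphic on the box.** [folklore] -/
theorem differentiableOn_DQ_right (hc : JetControl E δ η R) {x : ℂ} (hx : x ∈ jetBox R η) :
    DifferentiableOn ℂ (fun y ↦ DQ E x y) (jetBox R η) := by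
  have : (fun y ↦ DQ E x y) = fun y ↦ DQ E y x := funext fun y ↦ DQ_comm E x y
  rw [this]
  exact differentiableOn_DQ_left hc hx

/-- **Integral representation**: `DQ E x y = ∫₀¹ E'(y + t(x − y)) dt` on the (convex) box.
[folklore] -/
theorem DQ_eq_integral (hc : JetControl E δ η R) {x y : ℂ} (hx : x ∈ jetBox R η) (hy : y ∈ jetBox R η) :
    DQ E x y = ∫ t in (0 : ℝ)..1, deriv E (y + (t : ℂ) * (x - y)) := by
  have hseg : ∀ t ∈ Icc (0 : ℝ) 1, y + (t : ℂ) * (x - y) ∈ jetBox R η := fun t ht ↦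
    add_smul_sub_mem_jetBox hx hy ht
  have hcont : ContinuousOn (fun t : ℝ ↦ deriv E (y + t • (x - y))) (Icc 0 1) := by
    have hγ : Continuous fun t : ℝ ↦ y + (t : ℂ) * (x - y) := by fun_prop
    have := hc.continuousOn_deriv.comp hγ.continuousOn (fun t ht ↦ hseg t ht)
    simpa [Function.comp_def, smul_eq_mul] using this
  have hderiv : ∀ t ∈ Icc (0 : ℝ) 1, HasDerivAt E (deriv E (y + t • (x - y))) (y + t • (x - y)) := by
    intro t ht
    have hmem : y + (t : ℂ) * (x - y) ∈ jetBox R η := hseg t ht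
    have := (hc.differentiableOn.differentiableAt ((isOpen_jetBox R η).mem_nhds hmem)).hasDerivAt
    simpa [smul_eq_mul] using this
  have hftc := intervalIntegral.integral_unitInterval_deriv_eq_sub hcont hderiv
  simp only [smul_eq_mul, add_sub_cancel] at hftc
  -- `hftc : (x - y) * ∫ … = E x - E y`
  rcases eq_or_ne x y with rfl | hne
  · simp [DQ_same]
  · have hxy : x - y ≠ 0 := sub_ne_zero.2 hne
    have hftc' : (x - y) * ∫ t in (0 : ℝ)..1, deriv E (y + (t : ℂ) * (x - y)) = E x - E y := by
      simpa [Complex.real_smul] using hftc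
    rw [DQ_of_ne E hne, div_eq_iff hxy, mul_comm]
    exact hftc'.symm

/-- **`Re DQ ≥ δ` and `|DQ| ≤ 2` on the box** (the integrand has these bounds pointwise).
[cite: LawlerSchrammWerner2003Restriction, (8.2) (h'(W) ≤ (h(W) − h(O))/(W − O) ≤ h'(O) ≤ 1)] -/
theorem le_re_DQ_and_norm_DQ_le (hc : JetControl E δ η R) {x y : ℂ} (hx : x ∈ jetBox R η)
    (hy : y ∈ jetBox R η) : δ ≤ (DQ E x y).re ∧ ‖DQ E x y‖ ≤ 2 := by
  have hseg : ∀ t ∈ Icc (0 : ℝ) 1, y + (t : ℂ) * (x - y) ∈ jetBox R η := fun t ht ↦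
    add_smul_sub_mem_jetBox hx hy ht
  set f : ℝ → ℂ := fun t ↦ deriv E (y + (t : ℂ) * (x - y)) with hf
  have hcont : ContinuousOn f (Icc 0 1) := by
    have hγ : Continuous fun t : ℝ ↦ y + (t : ℂ) * (x - y) := by fun_prop
    exact hc.continuousOn_deriv.comp hγ.continuousOn (fun t ht ↦ hseg t ht)
  have hint : IntervalIntegrable f volume 0 1 := hcont.intervalIntegrable_of_Icc zero_le_one
  have hDQ : DQ E x y = ∫ t in (0 : ℝ)..1, f t := DQ_eq_integral hc hx hy
  constructor
  · -- real part: `Re ∫ = ∫ Re ≥ ∫ δ = δ`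
    have hre : (DQ E x y).re = ∫ t in (0 : ℝ)..1, (f t).re := by
      rw [hDQ]
      have h := ContinuousLinearMap.intervalIntegral_comp_comm Complex.reCLM hint
      simpa using h.symm
    rw [hre]
    have hmono : (∫ _ in (0 : ℝ)..1, δ) ≤ ∫ t in (0 : ℝ)..1, (f t).re :=
      intervalIntegral.integral_mono_on zero_le_one intervalIntegrable_const
        ((Complex.continuous_re.comp_continuousOn hcont).intervalIntegrable_of_Icc zero_le_one)
        (fun t ht ↦ hc.le_re_deriv _ (hseg t ht))
    simpa using hmono
  · rw [hDQ]
    have h := intervalIntegral.norm_integral_le_of_norm_le_const (a := (0 : ℝ)) (b := 1) (C := 2)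
      (f := f) (fun t ht ↦ by
        rw [uIoc_of_le zero_le_one] at ht
        exact hc.norm_deriv_le _ (hseg t ⟨ht.1.le, ht.2⟩))
    simpa using h

end DQ

/-! ### The logarithms: bounds and holomorphy of `ell` -/

/-- The bound `|log δ| + log 2 + π` for `|log w|` when `δ ≤ Re w` and `|w| ≤ 2`. [folklore] -/
def logBound (δ : ℝ) : ℝ := |Real.log δ| + Real.log 2 + Real.pi

/-- `0 < logBound δ`. [folklore] -/
theorem logBound_pos (δ : ℝ) : 0 < logBound δ := by
  have h1 : 0 ≤ |Real.log δ| := abs_nonneg _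
  have h2 : 0 ≤ Real.log 2 := Real.log_nonneg (by norm_num)
  have h3 := Real.pi_pos
  rw [logBound]; linarith

/-- **`|log w| ≤ logBound δ`** for `0 < δ ≤ Re w`, `|w| ≤ 2` (`Re log w = log |w| ∈ [log δ, log 2]`,
`|Im log w| = |arg w| ≤ π`). [folklore] -/
theorem norm_log_le_logBound {δ : ℝ} (hδ : 0 < δ) {w : ℂ} (hre : δ ≤ w.re) (hn : ‖w‖ ≤ 2) :
    ‖Complex.log w‖ ≤ logBound δ := by
  have hw : δ ≤ ‖w‖ := hre.trans (re_le_norm w)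
  have hwpos : 0 < ‖w‖ := hδ.trans_le hw
  have h1 : |(Complex.log w).re| ≤ |Real.log δ| + Real.log 2 := by
    rw [Complex.log_re, abs_le]
    constructor
    · have : Real.log δ ≤ Real.log ‖w‖ := Real.log_le_log hδ hw
      have : -|Real.log δ| ≤ Real.log δ := neg_abs_le _
      have : 0 ≤ Real.log 2 := Real.log_nonneg (by norm_num)
      linarith
    · have : Real.log ‖w‖ ≤ Real.log 2 := Real.log_le_log hwpos hn
      have : 0 ≤ |Real.log δ| := abs_nonneg _
      linarith
  have h2 : |(Complex.log w).im| ≤ Real.pi := by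
    rw [Complex.log_im]; exact abs_arg_le_pi w
  calc ‖Complex.log w‖ ≤ |(Complex.log w).re| + |(Complex.log w).im| := norm_le_abs_re_add_abs_im _
    _ ≤ |Real.log δ| + Real.log 2 + Real.pi := add_le_add h1 h2

/-- **`log M` as a function of the two evaluation points**: for the reflected map `E = E_B` of the
slid hull, `ell E ρ x y = (5/8) log E'(x) + b log E'(y) + c log DQ E x y`, so that
`M_t = exp (ell E_{A_t − W_t} ρ 0 (O_t − W_t))` ([LSW]: `M = h'(W)^{5/8} h'(O)^b ((h(W) − h(O))/(W − O))^c`,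
`b = ρ(4 + 3ρ)/32`, `c = 3ρ/8`). [cite: LawlerSchrammWerner2003Restriction, §8.4 (definition of M_t) and proof of Lemma 8.9] -/
def ell (E : ℂ → ℂ) (ρ : ℝ) (x y : ℂ) : ℂ :=
  (5 / 8 : ℂ) * Complex.log (deriv E x) + (expB ρ : ℂ) * Complex.log (deriv E y) +
    (expC ρ : ℂ) * Complex.log (DQ E x y)

/-- The uniform bound `(5/8 + |b| + |c|) · logBound δ` for `|ell|` on the box. [folklore] -/
def ellBound (ρ δ : ℝ) : ℝ := (5 / 8 + |expB ρ| + |expC ρ|) * logBound δ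

/-- `0 < ellBound ρ δ`. [folklore] -/
theorem ellBound_pos (ρ δ : ℝ) : 0 < ellBound ρ δ :=
  mul_pos (by positivity) (logBound_pos δ)

section Ell

variable {E : ℂ → ℂ} {δ η R : ℝ} {ρ : ℝ}

/-- **`|ell E ρ x y| ≤ ellBound ρ δ` on the box.** [folklore] -/
theorem norm_ell_le (hc : JetControl E δ η R) (ρ : ℝ) {x y : ℂ} (hx : x ∈ jetBox R η)
    (hy : y ∈ jetBox R η) : ‖ell E ρ x y‖ ≤ ellBound ρ δ := by
  have hL1 := norm_log_le_logBound hc.δ_pos (hc.le_re_deriv x hx) (hc.norm_deriv_le x hx)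
  have hL2 := norm_log_le_logBound hc.δ_pos (hc.le_re_deriv y hy) (hc.norm_deriv_le y hy)
  obtain ⟨hre, hn⟩ := le_re_DQ_and_norm_DQ_le hc hx hy
  have hL3 := norm_log_le_logBound hc.δ_pos hre hn
  have hΛ := (logBound_pos δ).le
  rw [ell, ellBound]
  have e1 : ‖(5 / 8 : ℂ) * Complex.log (deriv E x)‖ ≤ 5 / 8 * logBound δ := by
    rw [norm_mul]
    have : ‖(5 / 8 : ℂ)‖ = 5 / 8 := by norm_num
    rw [this]
    exact mul_le_mul_of_nonneg_left hL1 (by norm_num)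
  have e2 : ‖(expB ρ : ℂ) * Complex.log (deriv E y)‖ ≤ |expB ρ| * logBound δ := by
    rw [norm_mul, Complex.norm_real, Real.norm_eq_abs]
    exact mul_le_mul_of_nonneg_left hL2 (abs_nonneg _)
  have e3 : ‖(expC ρ : ℂ) * Complex.log (DQ E x y)‖ ≤ |expC ρ| * logBound δ := by
    rw [norm_mul, Complex.norm_real, Real.norm_eq_abs]
    exact mul_le_mul_of_nonneg_left hL3 (abs_nonneg _)
  calc _ ≤ ‖(5 / 8 : ℂ) * Complex.log (deriv E x) + (expB ρ : ℂ) * Complex.log (deriv E y)‖ +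
        ‖(expC ρ : ℂ) * Complex.log (DQ E x y)‖ := norm_add_le _ _
    _ ≤ (‖(5 / 8 : ℂ) * Complex.log (deriv E x)‖ + ‖(expB ρ : ℂ) * Complex.log (deriv E y)‖) +
        ‖(expC ρ : ℂ) * Complex.log (DQ E x y)‖ := by gcongr; exact norm_add_le _ _
    _ ≤ (5 / 8 * logBound δ + |expB ρ| * logBound δ) + |expC ρ| * logBound δ := by
        gcongr
    _ = (5 / 8 + |expB ρ| + |expC ρ|) * logBound δ := by ring

/-- `DQ E x y` lies in the slit plane on the box. [folklore] -/
theorem DQ_mem_slitPlane (hc : JetControl E δ η R) {x y : ℂ} (hx : x ∈ jetBox R η)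
    (hy : y ∈ jetBox R η) : DQ E x y ∈ slitPlane :=
  mem_slitPlane_iff.2 (Or.inl (hc.δ_pos.trans_le (le_re_DQ_and_norm_DQ_le hc hx hy).1))

/-- **`x ↦ ell E ρ x y` is holomorphic on the box** (for `y` in the box). [folklore] -/
theorem differentiableOn_ell_left (hc : JetControl E δ η R) (ρ : ℝ) {y : ℂ} (hy : y ∈ jetBox R η) :
    DifferentiableOn ℂ (fun x ↦ ell E ρ x y) (jetBox R η) := by
  have h1 : DifferentiableOn ℂ (fun x ↦ Complex.log (deriv E x)) (jetBox R η) :=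
    hc.differentiableOn_deriv.clog fun x hx ↦ hc.deriv_mem_slitPlane hx
  have h3 : DifferentiableOn ℂ (fun x ↦ Complex.log (DQ E x y)) (jetBox R η) :=
    (differentiableOn_DQ_left hc hy).clog fun x hx ↦ DQ_mem_slitPlane hc hx hy
  unfold ell
  exact ((h1.const_mul _).add (differentiableOn_const _)).add (h3.const_mul _)

/-- **`y ↦ ell E ρ x y` is holomorphic on the box** (for `x` in the box). [folklore] -/
theorem differentiableOn_ell_right (hc : JetControl E δ η R) (ρ : ℝ) {x : ℂ} (hx : x ∈ jetBox R η) :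
    DifferentiableOn ℂ (fun y ↦ ell E ρ x y) (jetBox R η) := by
  have h2 : DifferentiableOn ℂ (fun y ↦ Complex.log (deriv E y)) (jetBox R η) :=
    hc.differentiableOn_deriv.clog fun y hy ↦ hc.deriv_mem_slitPlane hy
  have h3 : DifferentiableOn ℂ (fun y ↦ Complex.log (DQ E x y)) (jetBox R η) :=
    (differentiableOn_DQ_right hc hx).clog fun y hy ↦ DQ_mem_slitPlane hc hx hy
  unfold ell
  exact (((differentiableOn_const _).add (h2.const_mul _))).add (h3.const_mul _)

/-- The `x`-slice is holomorphic on `ball 0 η`. [folklore] -/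
theorem differentiableOn_ell_left_ball (hc : JetControl E δ η R) (ρ : ℝ) {y : ℂ} (hy : y ∈ jetBox R η) :
    DifferentiableOn ℂ (fun x ↦ ell E ρ x y) (ball (0 : ℂ) η) :=
  (differentiableOn_ell_left hc ρ hy).mono (ball_zero_subset_jetBox hc.R_nonneg hc.η_pos hc.η_le_one)

/-- The `y`-slice is holomorphic on `ball y₀ η` for real `y₀ ∈ [−R−2, η]`. [folklore] -/
theorem differentiableOn_ell_right_ball (hc : JetControl E δ η R) (ρ : ℝ) {x : ℂ} (hx : x ∈ jetBox R η)
    {y₀ : ℝ} (hy₀ : y₀ ∈ Icc (-R - 2) η) :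
    DifferentiableOn ℂ (fun y ↦ ell E ρ x y) (ball (y₀ : ℂ) η) :=
  (differentiableOn_ell_right hc ρ hx).mono (ball_subset_jetBox hc.η_le_one hy₀)

/-- The bound on the `x`-slice over `ball 0 η`. [folklore] -/
theorem norm_ell_le_of_mem_ball_left (hc : JetControl E δ η R) (ρ : ℝ) {y : ℂ} (hy : y ∈ jetBox R η) :
    ∀ x ∈ ball (0 : ℂ) η, ‖ell E ρ x y‖ ≤ ellBound ρ δ := fun _ hx ↦
  norm_ell_le hc ρ (ball_zero_subset_jetBox hc.R_nonneg hc.η_pos hc.η_le_one hx) hy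

/-- The bound on the `y`-slice over `ball y₀ η`. [folklore] -/
theorem norm_ell_le_of_mem_ball_right (hc : JetControl E δ η R) (ρ : ℝ) {x : ℂ} (hx : x ∈ jetBox R η)
    {y₀ : ℝ} (hy₀ : y₀ ∈ Icc (-R - 2) η) :
    ∀ y ∈ ball (y₀ : ℂ) η, ‖ell E ρ x y‖ ≤ ellBound ρ δ := fun _ hy ↦
  norm_ell_le hc ρ hx (ball_subset_jetBox hc.η_le_one hy₀ hy)

end Ell

/-! ### The expansion of `ell` at `(0, y₀)`: second order in `x`, first order in `y` -/

section Taylor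

variable {E : ℂ → ℂ} {δ η R : ℝ}

/-- **Taylor in `x`** (the `W`-direction, second order): for `y` in the box and `|x| ≤ η/4`,
`|ell(x, y) − ell(0, y) − x ∂ₓell(0, y) − ½ x² ∂ₓ²ell(0, y)| ≤ 16 · ellBound · |x|³/η³`.
[cite: LawlerSchrammWerner2003Restriction, proof of Lemma 8.9 (Itô's formula for dM_t: second order in dW)] -/
theorem norm_ell_sub_taylor_x (hc : JetControl E δ η R) (ρ : ℝ) {y : ℂ} (hy : y ∈ jetBox R η)
    {x : ℂ} (hx : ‖x‖ ≤ η / 4) :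
    ‖ell E ρ x y - ell E ρ 0 y - x * deriv (fun x ↦ ell E ρ x y) 0 -
        2⁻¹ * x ^ 2 * iteratedDeriv 2 (fun x ↦ ell E ρ x y) 0‖ ≤
      16 * ellBound ρ δ * ‖x‖ ^ 3 / η ^ 3 := by
  have h := norm_sub_taylor_two_le_of_forall_mem_ball hc.η_pos (differentiableOn_ell_left_ball hc ρ hy)
    (norm_ell_le_of_mem_ball_left hc ρ hy) (z := x) (by simpa using hx)
  simpa [sub_zero, smul_eq_mul, mul_assoc] using h

/-- **Taylor in `y`** (the `O`-direction, first order) at a real base point `y₀ ∈ [−R−2, η]`: for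
`|a| ≤ η/4`, `|ell(0, y₀ + a) − ell(0, y₀) − a ∂_y ell(0, y₀)| ≤ 8 · ellBound · |a|²/η²`.
[cite: LawlerSchrammWerner2003Restriction, proof of Lemma 8.9 (d[h(O_t)], d[h'(O_t)] have no dB term)] -/
theorem norm_ell_sub_taylor_y (hc : JetControl E δ η R) (ρ : ℝ) {y₀ : ℝ} (hy₀ : y₀ ∈ Icc (-R - 2) η)
    {a : ℂ} (ha : ‖a‖ ≤ η / 4) :
    ‖ell E ρ 0 (y₀ + a) - ell E ρ 0 y₀ - a * deriv (fun y ↦ ell E ρ 0 y) y₀‖ ≤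
      8 * ellBound ρ δ * ‖a‖ ^ 2 / η ^ 2 := by
  have h := norm_sub_sub_le_of_forall_mem_ball hc.η_pos (differentiableOn_ell_right_ball hc ρ hc.zero_mem hy₀)
    (norm_ell_le_of_mem_ball_right hc ρ hc.zero_mem hy₀) (z := y₀ + a) (by simpa using ha)
  simpa [smul_eq_mul, add_sub_cancel_left] using h

/-- **The `x`-slices at two nearby `y`'s differ by `O(|a|)`, uniformly on `ball 0 η`** (Lipschitz
bound in `y` from the Cauchy estimate). [folklore] -/
theorem norm_ell_sub_ell_le (hc : JetControl E δ η R) (ρ : ℝ) {y₀ : ℝ} (hy₀ : y₀ ∈ Icc (-R - 2) η)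
    {a : ℂ} (ha : ‖a‖ < η / 2) {x : ℂ} (hx : x ∈ ball (0 : ℂ) η) :
    ‖ell E ρ x (y₀ + a) - ell E ρ x y₀‖ ≤ 4 * ellBound ρ δ / η * ‖a‖ := by
  have hxB := ball_zero_subset_jetBox hc.R_nonneg hc.η_pos hc.η_le_one hx
  have h := norm_sub_le_mul_of_forall_mem_ball hc.η_pos (differentiableOn_ell_right_ball hc ρ hxB hy₀)
    (norm_ell_le_of_mem_ball_right hc ρ hxB hy₀) (z := y₀ + a) (w := y₀)
    (by rw [mem_ball, dist_eq_norm]; simpa using ha) (mem_ball_self (by linarith [hc.η_pos]))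
  simpa using h

/-- The difference of two `x`-slices is holomorphic on `ball 0 η`. [folklore] -/
theorem differentiableOn_ell_sub (hc : JetControl E δ η R) (ρ : ℝ) {y y' : ℂ} (hy : y ∈ jetBox R η)
    (hy' : y' ∈ jetBox R η) :
    DifferentiableOn ℂ (fun x ↦ ell E ρ x y - ell E ρ x y') (ball (0 : ℂ) η) :=
  (differentiableOn_ell_left_ball hc ρ hy).sub (differentiableOn_ell_left_ball hc ρ hy')

/-- Real points `y₀ + a`, `y₀ ∈ [−R−2, η]`, `|a| < η`, are in the box (as complex numbers, `a` may
be complex). [folklore] -/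
theorem add_mem_jetBox (hc : JetControl E δ η R) {y₀ : ℝ} (hy₀ : y₀ ∈ Icc (-R - 2) η) {a : ℂ}
    (ha : ‖a‖ < η) : (y₀ : ℂ) + a ∈ jetBox R η :=
  ball_subset_jetBox hc.η_le_one hy₀ (by rw [mem_ball, dist_eq_norm]; simpa using ha)

/-- A real `y₀ ∈ [−R−2, η]` is in the box. [folklore] -/
theorem ofReal_mem_jetBox (hc : JetControl E δ η R) {y₀ : ℝ} (hy₀ : y₀ ∈ Icc (-R - 2) η) :
    (y₀ : ℂ) ∈ jetBox R η :=
  ball_subset_jetBox hc.η_le_one hy₀ (mem_ball_self hc.η_pos)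

/-- The `x`-slice is analytic at every point of `ball 0 η` (used to exchange `deriv` and
differences). [folklore] -/
theorem contDiffAt_ell_left (hc : JetControl E δ η R) (ρ : ℝ) {y : ℂ} (hy : y ∈ jetBox R η) {x : ℂ}
    (hx : x ∈ ball (0 : ℂ) η) {n : WithTop ℕ∞} : ContDiffAt ℂ n (fun x ↦ ell E ρ x y) x :=
  ((differentiableOn_ell_left_ball hc ρ hy).analyticOnNhd isOpen_ball x hx).contDiffAt

/-- **The first `x`-coefficient is Lipschitz in `y`**: for real `y₀ ∈ [−R−2, η]` and `|a| < η/2`,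
`|∂ₓell(0, y₀ + a) − ∂ₓell(0, y₀)| ≤ 8 · ellBound · |a|/η²` (Cauchy estimate for the difference of
the two slices, which is `≤ 4 ellBound |a|/η` on `ball 0 η`). [folklore] -/
theorem norm_deriv_slice_sub_le (hc : JetControl E δ η R) (ρ : ℝ) {y₀ : ℝ} (hy₀ : y₀ ∈ Icc (-R - 2) η)
    {a : ℂ} (ha : ‖a‖ < η / 2) :
    ‖deriv (fun x ↦ ell E ρ x (y₀ + a)) 0 - deriv (fun x ↦ ell E ρ x y₀) 0‖ ≤
      8 * ellBound ρ δ * ‖a‖ / η ^ 2 := by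
  have hy := add_mem_jetBox hc hy₀ (a := a) (by linarith [hc.η_pos])
  have hy' := ofReal_mem_jetBox hc hy₀
  have hD := differentiableOn_ell_sub hc ρ hy hy'
  have hM : ∀ x ∈ ball (0 : ℂ) η, ‖ell E ρ x (y₀ + a) - ell E ρ x y₀‖ ≤ 4 * ellBound ρ δ / η * ‖a‖ :=
    fun x hx ↦ norm_ell_sub_ell_le hc ρ hy₀ ha hx
  have h := norm_deriv_le_of_forall_mem_ball hc.η_pos hD hM
  have hdiff : deriv (fun x ↦ ell E ρ x (y₀ + a) - ell E ρ x y₀) 0 =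
      deriv (fun x ↦ ell E ρ x (y₀ + a)) 0 - deriv (fun x ↦ ell E ρ x y₀) 0 := by
    have h1 := (contDiffAt_ell_left hc ρ hy (mem_ball_self hc.η_pos) (n := 1)).differentiableAt one_ne_zero
    have h2 := (contDiffAt_ell_left hc ρ hy' (mem_ball_self hc.η_pos) (n := 1)).differentiableAt one_ne_zero
    exact deriv_sub h1 h2
  rw [← hdiff]
  refine h.trans (le_of_eq ?_)
  field_simp
  ring

/-- **The second `x`-coefficient is Lipschitz in `y`**: `|∂ₓ²ell(0, y₀ + a) − ∂ₓ²ell(0, y₀)| ≤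
32 · ellBound · |a|/η³`. [folklore] -/
theorem norm_iteratedDeriv_slice_sub_le (hc : JetControl E δ η R) (ρ : ℝ) {y₀ : ℝ}
    (hy₀ : y₀ ∈ Icc (-R - 2) η) {a : ℂ} (ha : ‖a‖ < η / 2) :
    ‖iteratedDeriv 2 (fun x ↦ ell E ρ x (y₀ + a)) 0 - iteratedDeriv 2 (fun x ↦ ell E ρ x y₀) 0‖ ≤
      32 * ellBound ρ δ * ‖a‖ / η ^ 3 := by
  have hy := add_mem_jetBox hc hy₀ (a := a) (by linarith [hc.η_pos])
  have hy' := ofReal_mem_jetBox hc hy₀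
  have hD := differentiableOn_ell_sub hc ρ hy hy'
  have hM : ∀ x ∈ ball (0 : ℂ) η, ‖ell E ρ x (y₀ + a) - ell E ρ x y₀‖ ≤ 4 * ellBound ρ δ / η * ‖a‖ :=
    fun x hx ↦ norm_ell_sub_ell_le hc ρ hy₀ ha hx
  have h := norm_iteratedDeriv_two_le_of_forall_mem_ball hc.η_pos hD hM
  have hdiff : iteratedDeriv 2 (fun x ↦ ell E ρ x (y₀ + a) - ell E ρ x y₀) 0 =
      iteratedDeriv 2 (fun x ↦ ell E ρ x (y₀ + a)) 0 - iteratedDeriv 2 (fun x ↦ ell E ρ x y₀) 0 :=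
    iteratedDeriv_fun_sub (contDiffAt_ell_left hc ρ hy (mem_ball_self hc.η_pos))
      (contDiffAt_ell_left hc ρ hy' (mem_ball_self hc.η_pos))
  rw [← hdiff]
  refine h.trans (le_of_eq ?_)
  field_simp
  ring

/-- **Bounds on the coefficients** (Cauchy): `|∂ₓell(0,y₀)| ≤ 2 ellBound/η`,
`|∂ₓ²ell(0,y₀)| ≤ 8 ellBound/η²`, `|∂_y ell(0,y₀)| ≤ 2 ellBound/η`. [folklore] -/
theorem norm_coeff_le (hc : JetControl E δ η R) (ρ : ℝ) {y₀ : ℝ} (hy₀ : y₀ ∈ Icc (-R - 2) η) :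
    ‖deriv (fun x ↦ ell E ρ x y₀) 0‖ ≤ 2 * ellBound ρ δ / η ∧
      ‖iteratedDeriv 2 (fun x ↦ ell E ρ x y₀) 0‖ ≤ 8 * ellBound ρ δ / η ^ 2 ∧
      ‖deriv (fun y ↦ ell E ρ 0 y) y₀‖ ≤ 2 * ellBound ρ δ / η := by
  have hy' := ofReal_mem_jetBox hc hy₀
  refine ⟨norm_deriv_le_of_forall_mem_ball hc.η_pos (differentiableOn_ell_left_ball hc ρ hy')
      (norm_ell_le_of_mem_ball_left hc ρ hy'),
    norm_iteratedDeriv_two_le_of_forall_mem_ball hc.η_pos (differentiableOn_ell_left_ball hc ρ hy')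
      (norm_ell_le_of_mem_ball_left hc ρ hy'),
    norm_deriv_le_of_forall_mem_ball hc.η_pos (differentiableOn_ell_right_ball hc ρ hc.zero_mem hy₀)
      (norm_ell_le_of_mem_ball_right hc ρ hc.zero_mem hy₀)⟩

/-- **The joint expansion of `log M`** at `(0, y₀)`, second order in `x` (the increment of `W`)
and first order in `a` (the displacement of `O`), UNIFORMLY in the real base point
`y₀ ∈ [−R−2, η]` — in particular across the diagonal `y₀ = 0`: for `|x|, |a| ≤ η/4`,
`ell(x, y₀ + a) − ell(0, y₀) = ℓ₁ x + m₁ a + ½ ℓ₂ x² + O(|x|³ + |x||a| + |x|²|a| + |a|²)` with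
`ℓ₁ = ∂ₓell(0,y₀)`, `ℓ₂ = ∂ₓ²ell(0,y₀)`, `m₁ = ∂_y ell(0,y₀)` and explicit constants.
[cite: LawlerSchrammWerner2003Restriction, proof of Lemma 8.9 (the semimartingale decomposition of M_t = exp L_t)] -/
theorem norm_ell_sub_ell_sub_le (hc : JetControl E δ η R) (ρ : ℝ) {y₀ : ℝ} (hy₀ : y₀ ∈ Icc (-R - 2) η)
    {x a : ℂ} (hx : ‖x‖ ≤ η / 4) (ha : ‖a‖ ≤ η / 4) :
    ‖ell E ρ x (y₀ + a) - ell E ρ 0 y₀ -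
        (deriv (fun x ↦ ell E ρ x y₀) 0 * x + deriv (fun y ↦ ell E ρ 0 y) y₀ * a +
          2⁻¹ * iteratedDeriv 2 (fun x ↦ ell E ρ x y₀) 0 * x ^ 2)‖ ≤
      ellBound ρ δ * (16 * ‖x‖ ^ 3 / η ^ 3 + 8 * ‖x‖ * ‖a‖ / η ^ 2 + 16 * ‖x‖ ^ 2 * ‖a‖ / η ^ 3 +
        8 * ‖a‖ ^ 2 / η ^ 2) := by
  have hη := hc.η_pos
  have ha' : ‖a‖ < η / 2 := by linarith
  have hya := add_mem_jetBox hc hy₀ (a := a) (by linarith)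
  -- the four pieces
  have h1 := norm_ell_sub_taylor_x hc ρ hya hx
  have h2 := norm_deriv_slice_sub_le hc ρ hy₀ ha'
  have h3 := norm_iteratedDeriv_slice_sub_le hc ρ hy₀ ha'
  have h4 := norm_ell_sub_taylor_y hc ρ hy₀ ha
  set L := ell E ρ x (y₀ + a) with hL
  set L0a := ell E ρ 0 (y₀ + a) with hL0a
  set L00 := ell E ρ 0 y₀ with hL00
  set d1a := deriv (fun x ↦ ell E ρ x (y₀ + a)) 0 with hd1a
  set d1 := deriv (fun x ↦ ell E ρ x y₀) 0 with hd1
  set d2a := iteratedDeriv 2 (fun x ↦ ell E ρ x (y₀ + a)) 0 with hd2a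
  set d2 := iteratedDeriv 2 (fun x ↦ ell E ρ x y₀) 0 with hd2
  set m1 := deriv (fun y ↦ ell E ρ 0 y) y₀ with hm1
  have hsplit : L - L00 - (d1 * x + m1 * a + 2⁻¹ * d2 * x ^ 2) =
      (L - L0a - x * d1a - 2⁻¹ * x ^ 2 * d2a) + x * (d1a - d1) + 2⁻¹ * x ^ 2 * (d2a - d2) +
        (L0a - L00 - a * m1) := by ring
  rw [hsplit]
  have e2 : ‖x * (d1a - d1)‖ ≤ ‖x‖ * (8 * ellBound ρ δ * ‖a‖ / η ^ 2) := by
    rw [norm_mul]; exact mul_le_mul_of_nonneg_left h2 (norm_nonneg _)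
  have e3 : ‖2⁻¹ * x ^ 2 * (d2a - d2)‖ ≤ 2⁻¹ * ‖x‖ ^ 2 * (32 * ellBound ρ δ * ‖a‖ / η ^ 3) := by
    rw [norm_mul, norm_mul, norm_inv, norm_pow]
    have : ‖(2 : ℂ)‖ = 2 := by norm_num
    rw [this]
    exact mul_le_mul_of_nonneg_left h3 (by positivity)
  calc _ ≤ ‖L - L0a - x * d1a - 2⁻¹ * x ^ 2 * d2a‖ + ‖x * (d1a - d1)‖ + ‖2⁻¹ * x ^ 2 * (d2a - d2)‖ +
        ‖L0a - L00 - a * m1‖ := by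
          refine (norm_add_le _ _).trans (add_le_add ((norm_add_le _ _).trans (add_le_add
            ((norm_add_le _ _).trans le_rfl) le_rfl)) le_rfl)
    _ ≤ 16 * ellBound ρ δ * ‖x‖ ^ 3 / η ^ 3 + ‖x‖ * (8 * ellBound ρ δ * ‖a‖ / η ^ 2) +
        2⁻¹ * ‖x‖ ^ 2 * (32 * ellBound ρ δ * ‖a‖ / η ^ 3) + 8 * ellBound ρ δ * ‖a‖ ^ 2 / η ^ 2 := by
          gcongr
    _ = _ := by ring

end Taylor

/-! ### Exponentiation: `dM/M = dL + ½ (dL)²` -/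

/-- `|exp s − 1 − s − s²/2| ≤ |s|³` for `|s| ≤ 1`. [folklore] -/
theorem norm_exp_sub_one_sub_le {s : ℂ} (hs : ‖s‖ ≤ 1) :
    ‖Complex.exp s - 1 - s - s ^ 2 / 2‖ ≤ ‖s‖ ^ 3 := by
  have h := Complex.exp_bound hs (n := 3) (by norm_num)
  have hsum : ∑ m ∈ Finset.range 3, s ^ m / (m.factorial : ℂ) = 1 + s + s ^ 2 / 2 := by
    simp [Finset.sum_range_succ, Nat.factorial]
  rw [hsum] at h
  have heq : Complex.exp s - 1 - s - s ^ 2 / 2 = Complex.exp s - (1 + s + s ^ 2 / 2) := by ring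
  rw [heq]
  refine h.trans ?_
  have : ((Nat.succ 3 : ℕ) : ℝ) * ((Nat.factorial 3 : ℕ) * (3 : ℕ) : ℝ)⁻¹ ≤ 1 := by
    norm_num [Nat.factorial]
  calc ‖s‖ ^ 3 * (((Nat.succ 3 : ℕ) : ℝ) * ((Nat.factorial 3 : ℕ) * (3 : ℕ) : ℝ)⁻¹) ≤ ‖s‖ ^ 3 * 1 := by
        gcongr
    _ = ‖s‖ ^ 3 := mul_one _

/-- **`exp Δ − 1 = L + Q + ½ L² + (remainder)`**, the algebra of `dM/M = dL + ½(dL)²`: if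
`Δ = L + Q + err` with `|Δ| ≤ 1`, then
`|exp Δ − 1 − (L + Q + ½ L²)| ≤ |Δ|³ + |err| + ½ |Q + err| (2|L| + |Q + err|)`
(here `L = ℓ₁ x` is the first-order term in the increment of `W`, and `Q = m₁ a + ½ ℓ₂ x²`).
[cite: LawlerSchrammWerner2003Restriction, proof of Lemma 8.9 (Itô's formula for dM_t with M = exp L)] -/
theorem norm_exp_sub_model_le {Δ L Q err : ℂ} (hΔ : Δ = L + Q + err) (h1 : ‖Δ‖ ≤ 1) :
    ‖Complex.exp Δ - 1 - (L + Q + 2⁻¹ * L ^ 2)‖ ≤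
      ‖Δ‖ ^ 3 + ‖err‖ + 2⁻¹ * (‖Q + err‖ * (2 * ‖L‖ + ‖Q + err‖)) := by
  have hsplit : Complex.exp Δ - 1 - (L + Q + 2⁻¹ * L ^ 2) =
      (Complex.exp Δ - 1 - Δ - Δ ^ 2 / 2) + err + 2⁻¹ * ((Q + err) * (2 * L + (Q + err))) := by
    rw [hΔ]; ring
  rw [hsplit]
  have e1 := norm_exp_sub_one_sub_le h1
  have e3 : ‖(2 : ℂ)⁻¹ * ((Q + err) * (2 * L + (Q + err)))‖ ≤ 2⁻¹ * (‖Q + err‖ * (2 * ‖L‖ + ‖Q + err‖)) := by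
    rw [norm_mul, norm_mul, norm_inv]
    have : ‖(2 : ℂ)‖ = 2 := by norm_num
    rw [this]
    gcongr
    calc ‖2 * L + (Q + err)‖ ≤ ‖2 * L‖ + ‖Q + err‖ := norm_add_le _ _
      _ = 2 * ‖L‖ + ‖Q + err‖ := by rw [norm_mul]; norm_num
  calc _ ≤ ‖Complex.exp Δ - 1 - Δ - Δ ^ 2 / 2‖ + ‖err‖ + ‖(2 : ℂ)⁻¹ * ((Q + err) * (2 * L + (Q + err)))‖ :=
        (norm_add_le _ _).trans (add_le_add (norm_add_le _ _) le_rfl)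
    _ ≤ _ := by gcongr

end SLEKappaRho

end Literature.Probability.RandomPlanarGeometry

end
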